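import Literature.Analysis.FluidPDE.AncientMildRepresentative
import Literature.Analysis.FluidPDE.KNSSAxisymmetricNoSwirl
import HarnessLib

/-!
# Jointly measurable modifications modulo spatial constants

Analysis/FluidPDE support file (all results proved) on the path from Koch–Nadirashvili–Seregin–
Šverák's Theorem 5.2 as printed (`Literature.Analysis.FluidPDE.KNSS2009_liouville_axisymmetric_no_swirl`)
to the slice-wise renderings `Literature.Analysis.FluidPDE.knss_axisymmetric_no_swirl`,
`Literature.Analysis.FluidPDE.knss_axisymmetric_no_swirl'` of `SelfSimilarLiouville`, whose
hypotheses ask only for measurable *slices* of a bounded ancient mild solution in the duality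
form. Companion of `AncientMildRepresentative` (the decaying case, where the family is weak-*
continuous and has a jointly measurable modification): without decay the family is weak-*
continuous only **modulo spatial constants** — `t ↦ ∫⟪u(t), θ − θ(· − b)⟫` is continuous for
every test field `θ` and every `b` (`AncientMildWeakStar.continuousOn_integral_inner_sub_translate`),
the time-dependent constant `b(t)` of KNSS 2009, §1 p. 3 being invisible — and this file draws the
consequence:

* `continuousOn_convolution_normed_sub` (any dimension): for a bounded family with measurable
  slices whose pairings with differences of translates of test fields are continuous in time, the
  *increments* of the spatial mollifications, `(t, x) ↦ (ρ ⋆ u(t))(x) − (ρ ⋆ u(t))(x₁)`, are jointly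
  continuous on `(−∞, 0) × E` (the components are pairings with `ρ(x − ·)bᵢ − ρ(x₁ − ·)bᵢ`, a
  difference of translates moving continuously in `L¹`).
* `exists_stronglyMeasurable_modification_sub_average` (any dimension): such a family admits a
  jointly (strongly) measurable `w` with `w(t) = u(t) − ⟨u(t)⟩_g` a.e. for **every** `t < 0`, where
  `⟨u(t)⟩_g = ∫ g u(t)` is the average against a fixed test weight `g` of unit mass: `w` is the
  pointwise limit of the recentred mollifications `ρₙ ⋆ u(t) − ∫ g (ρₙ ⋆ u(t))`, which are jointly
  continuous, and converge a.e. on every slice (Lebesgue differentiation and dominated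
  convergence). For bounded ancient mild solutions:
  `IsBoundedAncientMildSolution.exists_modification_sub_average` (with a bounded `w`).
* `measurable_integral_inner_heatTest_fderiv` / `…_apply`: for a jointly measurable bounded `w`,
  the nonlinear integrands `τ ↦ ∫⟪w τ, D(e^{ν(q−τ)Δ}φ)[w τ]⟫` and `τ ↦ ∫⟪w τ, ∂ₑe^{ν(q−τ)Δ}φ⟫`
  are measurable in `τ`.
* (`ℝ³`) `exists_radial_test_weight`, `integral_smul_eq_smul_eZ_of_isAxisymmetric`: there is a
  smooth compactly supported weight of unit mass invariant under the rotations about the axis, and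
  the average of a pointwise axisymmetric field against it is axial, `∫ g u = (∫ g u₂) e_z` — so for
  axisymmetric families the invisible constant is `c(t) e_z` with a *scalar* `c`.

## References

* G. Koch, N. Nadirashvili, G. Seregin, V. Šverák, *Liouville theorems for the Navier–Stokes
  equations and applications*, Acta Math. 203 (2009) 83–105 = arXiv:0709.3599, §1 p. 3 (the
  parasitic solutions `u(x,t) = b(t)`), §3 p. 7 (`b` bounded measurable for weak solutions in
  `L^∞`), Thm 5.2 pp. 9–10. [KochNadirashviliSereginSverak2009]
* L. C. Evans, *Partial Differential Equations*, 2nd ed. (AMS 2010), App. C.4, Thm. 7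
  (mollifiers). [Evans2010]
-/

noncomputable section

open MeasureTheory Set Function Filter Topology TopologicalSpace InnerProductSpace ContinuousLinearMap
open scoped RealInnerProductSpace NNReal ENNReal ContDiff Convolution

namespace Literature.Analysis.FluidPDE

variable {E : Type*} [NormedAddCommGroup E] [InnerProductSpace ℝ E] [FiniteDimensional ℝ E]
  [MeasurableSpace E] [BorelSpace E]

/-! ### Increments of the mollification of a family continuous modulo constants -/

section Mollify

variable {u : ℝ → E → E} {M : ℝ}

/-- **A mollification of a bounded field is bounded by the same constant**: `‖(ρ ⋆ w)(x)‖ ≤ M` if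
`‖w‖ ≤ M` (`ρ.normed ≥ 0` has unit mass). [folklore] -/
theorem norm_convolution_normed_le (ρ : ContDiffBump (0 : E)) {w : E → E} {M : ℝ}
    (hM : ∀ x, ‖w x‖ ≤ M) (x : E) :
    ‖(ρ.normed volume ⋆[lsmul ℝ ℝ, volume] w) x‖ ≤ M := by
  set f : E → ℝ := ρ.normed volume with hf_def
  have hf : FunctionSpaces.IsTestFunctionOn (⊤ : Opens E) f := FunctionSpaces.isTestFunctionOn_normed ρ
  have hconv : (f ⋆[lsmul ℝ ℝ, volume] w) x = ∫ z, f (x - z) • w z := by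
    rw [convolution_eq_swap]
    simp only [lsmul_apply]
  have hfx := hf.comp_sub_left x
  have hfxi : Integrable (fun z => f (x - z)) volume :=
    hfx.contDiff.continuous.integrable_of_hasCompactSupport hfx.hasCompactSupport
  have hone : ∫ z, f (x - z) = 1 := by
    rw [integral_sub_left_eq_self f volume x]
    exact ρ.integral_normed
  rw [hconv]
  calc ‖∫ z, f (x - z) • w z‖ ≤ ∫ z, f (x - z) * M := by
        refine norm_integral_le_of_norm_le (hfxi.mul_const M) (Eventually.of_forall fun z => ?_)
        rw [norm_smul, Real.norm_of_nonneg (ρ.nonneg_normed _)]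
        exact mul_le_mul_of_nonneg_left (hM z) (ρ.nonneg_normed _)
    _ = M := by rw [integral_mul_const, hone, one_mul]

/-- **Joint continuity of the increments of one pairing component.** Let `u(t) : E → E`, `t < 0`,
be bounded by `M` with measurable slices, and suppose that for every test field `θ` and every
`b` the pairing `t ↦ ∫⟪u(t), θ − θ(· − b)⟫` is continuous on `(−∞, 0)`. Then for every vector `c`
and base point `x₁`, `(t, x) ↦ ∫⟪u(t), ρ(x − ·) c⟫ − ∫⟪u(t), ρ(x₁ − ·) c⟫` is continuous on
`(−∞, 0) × E`: in `x` the test field `ρ(x − ·) c` moves continuously in `L¹`, against which the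
pairing is `M`-Lipschitz uniformly in `t`, and in `t` the increment is a pairing with the
difference of translates `θ − θ(· − (x₁ − x₀))`, `θ = ρ(x₀ − ·) c`. [folklore] -/
theorem continuousOn_integral_inner_normed_smul_sub (ρ : ContDiffBump (0 : E))
    (hM : ∀ t < 0, ∀ x, ‖u t x‖ ≤ M) (hmeas : ∀ t < 0, AEStronglyMeasurable (u t) volume)
    (hsub : ∀ θ : E → E, FunctionSpaces.IsTestFunctionOn (⊤ : Opens E) θ → ∀ b : E,
      ContinuousOn (fun t => ∫ x, ⟪u t x, θ x - θ (x - b)⟫) (Iio 0)) (c x₁ : E) :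
    ContinuousOn (fun p : ℝ × E => (∫ z, ⟪u p.1 z, ρ.normed volume (p.2 - z) • c⟫) -
      ∫ z, ⟪u p.1 z, ρ.normed volume (x₁ - z) • c⟫) (Iio 0 ×ˢ univ) := by
  have hf : FunctionSpaces.IsTestFunctionOn (⊤ : Opens E) (ρ.normed volume) :=
    FunctionSpaces.isTestFunctionOn_normed ρ
  have hfc : Continuous (ρ.normed volume) := ρ.continuous_normed
  have hM0 : 0 ≤ M := (norm_nonneg _).trans (hM (-1) (by norm_num) 0)
  -- the test fields `ψ x = ρ(x - ·) c`
  have hψ : ∀ x, FunctionSpaces.IsTestFunctionOn (⊤ : Opens E) (fun z => ρ.normed volume (x - z) • c) :=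
    fun x => ⟨(hf.comp_sub_left x).contDiff.smul contDiff_const,
      (hf.comp_sub_left x).hasCompactSupport.smul_right, by simp⟩
  have hψi : ∀ x, Integrable (fun z => ρ.normed volume (x - z) • c) volume := fun x =>
    (hψ x).contDiff.continuous.integrable_of_hasCompactSupport (hψ x).hasCompactSupport
  have hfxi : ∀ x, Integrable (fun z => ρ.normed volume (x - z)) volume := fun x =>
    (hfc.comp (continuous_const.sub continuous_id)).integrable_of_hasCompactSupport
      (hf.comp_sub_left x).hasCompactSupport
  intro p₀ hp₀
  have ht₀ : p₀.1 < 0 := (mem_prod.1 hp₀).1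
  -- `L¹` modulus of `x ↦ ψ x` at `p₀.2`
  have hF : Tendsto (fun x => ∫ z, |ρ.normed volume (x - z) - ρ.normed volume (p₀.2 - z)|)
      (𝓝 p₀.2) (𝓝 0) := tendsto_integral_abs_normed_sub ρ p₀.2
  -- the increment at the fixed points `p₀.2`, `x₁` is a pairing with a difference of translates
  have hg : ContinuousOn (fun t => (∫ z, ⟪u t z, ρ.normed volume (p₀.2 - z) • c⟫) -
      ∫ z, ⟪u t z, ρ.normed volume (x₁ - z) • c⟫) (Iio 0) := by
    refine (hsub _ (hψ p₀.2) (x₁ - p₀.2)).congr fun t ht => ?_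
    have i1 := integrable_inner_of_aestronglyMeasurable_of_norm_le (hmeas t ht) (hM t ht) (hψi p₀.2)
    have i2 := integrable_inner_of_aestronglyMeasurable_of_norm_le (hmeas t ht) (hM t ht) (hψi x₁)
    have heq : ∀ z, ρ.normed volume (p₀.2 - (z - (x₁ - p₀.2))) • c = ρ.normed volume (x₁ - z) • c :=
      fun z => by congr 2; abel
    show (∫ z, ⟪u t z, ρ.normed volume (p₀.2 - z) • c⟫) - ∫ z, ⟪u t z, ρ.normed volume (x₁ - z) • c⟫ =
      ∫ z, ⟪u t z, ρ.normed volume (p₀.2 - z) • c - ρ.normed volume (p₀.2 - (z - (x₁ - p₀.2))) • c⟫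
    rw [← integral_sub i1 i2]
    exact integral_congr_ae (Eventually.of_forall fun z => by simp only [heq z, inner_sub_right])
  -- piece A: change of the test field, uniformly `M`-Lipschitz in `L¹`
  have hA : Tendsto (fun p : ℝ × E => (∫ z, ⟪u p.1 z, ρ.normed volume (p.2 - z) • c⟫) -
      ∫ z, ⟪u p.1 z, ρ.normed volume (p₀.2 - z) • c⟫) (𝓝[Iio 0 ×ˢ univ] p₀) (𝓝 0) := by
    refine squeeze_zero_norm' (a := fun p : ℝ × E => M * ‖c‖ *
      ∫ z, |ρ.normed volume (p.2 - z) - ρ.normed volume (p₀.2 - z)|) ?_ ?_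
    · filter_upwards [self_mem_nhdsWithin] with p hp
      have ht : p.1 < 0 := (mem_prod.1 hp).1
      have i1 := integrable_inner_of_aestronglyMeasurable_of_norm_le (hmeas p.1 ht) (hM p.1 ht) (hψi p.2)
      have i2 := integrable_inner_of_aestronglyMeasurable_of_norm_le (hmeas p.1 ht) (hM p.1 ht) (hψi p₀.2)
      have idiff : Integrable (fun z => |ρ.normed volume (p.2 - z) - ρ.normed volume (p₀.2 - z)|) volume :=
        ((hfxi p.2).sub (hfxi p₀.2)).abs
      rw [← integral_sub i1 i2, Real.norm_eq_abs]
      calc |∫ z, (⟪u p.1 z, ρ.normed volume (p.2 - z) • c⟫ - ⟪u p.1 z, ρ.normed volume (p₀.2 - z) • c⟫)|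
          ≤ ∫ z, ‖⟪u p.1 z, ρ.normed volume (p.2 - z) • c⟫ -
              ⟪u p.1 z, ρ.normed volume (p₀.2 - z) • c⟫‖ := by
            rw [← Real.norm_eq_abs]
            exact norm_integral_le_integral_norm _
        _ ≤ ∫ z, M * ‖c‖ * |ρ.normed volume (p.2 - z) - ρ.normed volume (p₀.2 - z)| := by
            refine integral_mono_of_nonneg (Eventually.of_forall fun _ => norm_nonneg _)
              (idiff.const_mul (M * ‖c‖)) (Eventually.of_forall fun z => ?_)
            show ‖⟪u p.1 z, ρ.normed volume (p.2 - z) • c⟫ - ⟪u p.1 z, ρ.normed volume (p₀.2 - z) • c⟫‖ ≤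
              M * ‖c‖ * |ρ.normed volume (p.2 - z) - ρ.normed volume (p₀.2 - z)|
            rw [← inner_sub_right, ← sub_smul]
            refine (norm_inner_le_norm _ _).trans ?_
            rw [norm_smul, Real.norm_eq_abs]
            calc ‖u p.1 z‖ * (|ρ.normed volume (p.2 - z) - ρ.normed volume (p₀.2 - z)| * ‖c‖)
                ≤ M * (|ρ.normed volume (p.2 - z) - ρ.normed volume (p₀.2 - z)| * ‖c‖) :=
                  mul_le_mul_of_nonneg_right (hM p.1 ht z) (by positivity)
              _ = M * ‖c‖ * |ρ.normed volume (p.2 - z) - ρ.normed volume (p₀.2 - z)| := by ring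
        _ = M * ‖c‖ * ∫ z, |ρ.normed volume (p.2 - z) - ρ.normed volume (p₀.2 - z)| :=
            integral_const_mul _ _
    · have h : Tendsto (fun p : ℝ × E => M * ‖c‖ *
          ∫ z, |ρ.normed volume (p.2 - z) - ρ.normed volume (p₀.2 - z)|) (𝓝 p₀) (𝓝 0) := by
        have := (hF.comp (continuous_snd.tendsto p₀)).const_mul (M * ‖c‖)
        rwa [mul_zero] at this
      exact h.mono_left nhdsWithin_le_nhds
  -- piece B: change of time at the fixed increment
  have hB : Tendsto (fun p : ℝ × E => ((∫ z, ⟪u p.1 z, ρ.normed volume (p₀.2 - z) • c⟫) -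
      ∫ z, ⟪u p.1 z, ρ.normed volume (x₁ - z) • c⟫) - ((∫ z, ⟪u p₀.1 z, ρ.normed volume (p₀.2 - z) • c⟫) -
      ∫ z, ⟪u p₀.1 z, ρ.normed volume (x₁ - z) • c⟫)) (𝓝[Iio 0 ×ˢ univ] p₀) (𝓝 0) := by
    have hfst : Tendsto (fun p : ℝ × E => p.1) (𝓝[Iio 0 ×ˢ univ] p₀) (𝓝[Iio 0] p₀.1) := by
      refine tendsto_nhdsWithin_iff.2 ⟨?_, ?_⟩
      · exact (continuous_fst.tendsto p₀).mono_left nhdsWithin_le_nhds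
      · filter_upwards [self_mem_nhdsWithin] with p hp
        exact (mem_prod.1 hp).1
    have h := ((hg p₀.1 ht₀).tendsto.comp hfst).sub_const
      ((∫ z, ⟪u p₀.1 z, ρ.normed volume (p₀.2 - z) • c⟫) - ∫ z, ⟪u p₀.1 z, ρ.normed volume (x₁ - z) • c⟫)
    rw [sub_self] at h
    exact h
  have hsum := (hA.add hB).add_const
    ((∫ z, ⟪u p₀.1 z, ρ.normed volume (p₀.2 - z) • c⟫) - ∫ z, ⟪u p₀.1 z, ρ.normed volume (x₁ - z) • c⟫)
  rw [add_zero, zero_add] at hsum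
  refine hsum.congr fun p => ?_
  ring

/-- **Increments of the mollification of a family continuous modulo constants are jointly
continuous.** Under the hypotheses of `continuousOn_integral_inner_normed_smul_sub`, for a bump
`ρ` and a base point `x₁` the increment `(t, x) ↦ (ρ ⋆ u(t))(x) − (ρ ⋆ u(t))(x₁)` is continuous on
`(−∞, 0) × E` (its components in an orthonormal frame are the increments of the pairing
components, `convolution_normed_eq_sum_integral_inner`). [folklore] -/
theorem continuousOn_convolution_normed_sub (ρ : ContDiffBump (0 : E))
    (hM : ∀ t < 0, ∀ x, ‖u t x‖ ≤ M) (hmeas : ∀ t < 0, AEStronglyMeasurable (u t) volume)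
    (hsub : ∀ θ : E → E, FunctionSpaces.IsTestFunctionOn (⊤ : Opens E) θ → ∀ b : E,
      ContinuousOn (fun t => ∫ x, ⟪u t x, θ x - θ (x - b)⟫) (Iio 0)) (x₁ : E) :
    ContinuousOn (fun p : ℝ × E => (ρ.normed volume ⋆[lsmul ℝ ℝ, volume] (u p.1)) p.2 -
      (ρ.normed volume ⋆[lsmul ℝ ℝ, volume] (u p.1)) x₁) (Iio 0 ×ˢ univ) := by
  set b := stdOrthonormalBasis ℝ E
  have hsum : ContinuousOn (fun p : ℝ × E =>
      ∑ i, ((∫ z, ⟪u p.1 z, ρ.normed volume (p.2 - z) • b i⟫) -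
        ∫ z, ⟪u p.1 z, ρ.normed volume (x₁ - z) • b i⟫) • b i) (Iio 0 ×ˢ univ) :=
    continuousOn_finsetSum Finset.univ fun i _ =>
      (continuousOn_integral_inner_normed_smul_sub ρ hM hmeas hsub (b i) x₁).smul continuousOn_const
  refine hsum.congr ?_
  rintro ⟨t, x⟩ hp
  have ht : t < 0 := (mem_prod.1 hp).1
  show (ρ.normed volume ⋆[lsmul ℝ ℝ, volume] (u t)) x - (ρ.normed volume ⋆[lsmul ℝ ℝ, volume] (u t)) x₁ =
    ∑ i, ((∫ z, ⟪u t z, ρ.normed volume (x - z) • b i⟫) - ∫ z, ⟪u t z, ρ.normed volume (x₁ - z) • b i⟫) • b i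
  rw [convolution_normed_eq_sum_integral_inner ρ (hmeas t ht) (hM t ht) x,
    convolution_normed_eq_sum_integral_inner ρ (hmeas t ht) (hM t ht) x₁, ← Finset.sum_sub_distrib]
  exact Finset.sum_congr rfl fun i _ => by rw [sub_smul]

end Mollify

/-! ### A jointly measurable modification modulo the average against a fixed weight -/

section Modification

variable {u : ℝ → E → E} {M : ℝ}

/-- **The recentred mollifications are jointly continuous.** Under the hypotheses of
`continuousOn_convolution_normed_sub`, for a bump `ρ` and a continuous compactly supported
weight `g` of unit mass, `(t, x) ↦ (ρ ⋆ u(t))(x) − ∫ g(y) (ρ ⋆ u(t))(y) dy` is continuous on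
`(−∞, 0) × E`: it equals `D(t, x) − ∫ g(y) D(t, y) dy` for the increments
`D(t, x) = (ρ ⋆ u(t))(x) − (ρ ⋆ u(t))(0)` (unit mass), and the parametric integral of the jointly
continuous, uniformly compactly supported `g(y) D(t, y)` is continuous in `t`. [folklore] -/
theorem continuousOn_convolution_normed_sub_average (ρ : ContDiffBump (0 : E))
    (hM : ∀ t < 0, ∀ x, ‖u t x‖ ≤ M) (hmeas : ∀ t < 0, AEStronglyMeasurable (u t) volume)
    (hsub : ∀ θ : E → E, FunctionSpaces.IsTestFunctionOn (⊤ : Opens E) θ → ∀ b : E,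
      ContinuousOn (fun t => ∫ x, ⟪u t x, θ x - θ (x - b)⟫) (Iio 0))
    {g : E → ℝ} (hg : Continuous g) (hgc : HasCompactSupport g) (hg1 : ∫ y, g y = 1) :
    ContinuousOn (fun p : ℝ × E => (ρ.normed volume ⋆[lsmul ℝ ℝ, volume] (u p.1)) p.2 -
      ∫ y, g y • (ρ.normed volume ⋆[lsmul ℝ ℝ, volume] (u p.1)) y) (Iio 0 ×ˢ univ) := by
  set C : ℝ → E → E := fun t x => (ρ.normed volume ⋆[lsmul ℝ ℝ, volume] (u t)) x with hC
  have hD : ContinuousOn (fun p : ℝ × E => C p.1 p.2 - C p.1 0) (Iio 0 ×ˢ univ) :=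
    continuousOn_convolution_normed_sub ρ hM hmeas hsub 0
  have hgi : Integrable g := hg.integrable_of_hasCompactSupport hgc
  -- the parametric integral `t ↦ ∫ g(y) (C t y - C t 0) dy` is continuous on `(-∞, 0)`
  have hP : ContinuousOn (fun t => ∫ y, g y • (C t y - C t 0)) (Iio 0) := by
    refine continuousOn_integral_of_compact_support (k := tsupport g) hgc ?_ fun t y _ hy => ?_
    · have h1 : ContinuousOn (fun p : ℝ × E => g p.2) (Iio 0 ×ˢ univ) := (hg.comp continuous_snd).continuousOn
      exact h1.smul hD
    · simp [image_eq_zero_of_notMem_tsupport hy]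
  have hP' : ContinuousOn (fun p : ℝ × E => ∫ y, g y • (C p.1 y - C p.1 0)) (Iio 0 ×ˢ univ) :=
    hP.comp continuous_fst.continuousOn fun p hp => (mem_prod.1 hp).1
  refine ((hD.sub hP').congr ?_)
  rintro ⟨t, x⟩ hp
  have ht : t < 0 := (mem_prod.1 hp).1
  -- `∫ g (C t - C t 0) = ∫ g C t - C t 0` by unit mass
  have hCc : Continuous (C t) := by
    have hloc : LocallyIntegrable (u t) volume :=
      (memLp_top_of_bound (hmeas t ht) M (Eventually.of_forall (hM t ht))).locallyIntegrable le_top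
    exact ρ.hasCompactSupport_normed.continuous_convolution_left (L := lsmul ℝ ℝ) ρ.continuous_normed hloc
  have hCb : ∀ y, ‖C t y‖ ≤ M := fun y => norm_convolution_normed_le ρ (hM t ht) y
  have i1 : Integrable fun y => g y • C t y :=
    Integrable.mono' (hgi.norm.mul_const M) (hg.aestronglyMeasurable.smul hCc.aestronglyMeasurable)
      (Eventually.of_forall fun y => by
        rw [norm_smul]
        exact mul_le_mul_of_nonneg_left (hCb y) (norm_nonneg _))
  have i2 : Integrable fun y => g y • C t 0 := hgi.smul_const _
  show C t x - ∫ y, g y • C t y = (C t x - C t 0) - ∫ y, g y • (C t y - C t 0)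
  simp_rw [smul_sub]
  rw [integral_sub i1 i2, integral_smul_const, hg1, one_smul]
  abel

/-- **Bounded families continuous modulo constants have jointly measurable modifications modulo
their averages.** Let `u(t) : E → E`, `t < 0`, be bounded by `M`, with measurable slices, and
suppose that `t ↦ ∫⟪u(t), θ − θ(· − b)⟫` is continuous on `(−∞, 0)` for every test field `θ` and
every `b`. Then for every continuous compactly supported weight `g` of unit mass there is a
jointly (strongly) measurable `w : ℝ → E → E` with
`w(t) = u(t) − ∫ g(y) u(t, y) dy` a.e. for **every** `t < 0`: `w` is the pointwise limit (where it
exists) of the recentred mollifications `ρₙ ⋆ u(t) − ∫ g (ρₙ ⋆ u(t))` along a mollifier sequence,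
which are jointly continuous (`continuousOn_convolution_normed_sub_average`), hence measurable
after extension by zero, and converge a.e. on every slice (Lebesgue differentiation for the first
term, dominated convergence for the second). [folklore] -/
theorem exists_stronglyMeasurable_modification_sub_average
    (hM : ∀ t < 0, ∀ x, ‖u t x‖ ≤ M) (hmeas : ∀ t < 0, AEStronglyMeasurable (u t) volume)
    (hsub : ∀ θ : E → E, FunctionSpaces.IsTestFunctionOn (⊤ : Opens E) θ → ∀ b : E,
      ContinuousOn (fun t => ∫ x, ⟪u t x, θ x - θ (x - b)⟫) (Iio 0))
    {g : E → ℝ} (hg : Continuous g) (hgc : HasCompactSupport g) (hg1 : ∫ y, g y = 1) :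
    ∃ w : ℝ → E → E, StronglyMeasurable (uncurry w) ∧
      ∀ t < 0, w t =ᵐ[volume] fun x => u t x - ∫ y, g y • u t y := by
  obtain ⟨φ, hφ, h'φ⟩ := FunctionSpaces.exists_contDiffBump_seq (E := E)
  set S : Set (ℝ × E) := Iio 0 ×ˢ univ with hS_def
  have hS : MeasurableSet S := measurableSet_Iio.prod MeasurableSet.univ
  have hgi : Integrable g := hg.integrable_of_hasCompactSupport hgc
  -- the recentred mollified families, extended by zero to `t ≥ 0`, are jointly measurable
  set V : ℕ → ℝ × E → E := fun n p => ((φ n).normed volume ⋆[lsmul ℝ ℝ, volume] (u p.1)) p.2 -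
    ∫ y, g y • ((φ n).normed volume ⋆[lsmul ℝ ℝ, volume] (u p.1)) y with hV
  have hG : ∀ n, ∃ G : ℝ × E → E, StronglyMeasurable G ∧ ∀ p : ℝ × E, p.1 < 0 → G p = V n p := by
    intro n
    have hcont : ContinuousOn (V n) S :=
      continuousOn_convolution_normed_sub_average (φ n) hM hmeas hsub hg hgc hg1
    have hc' : Continuous (S.restrict (V n)) := continuousOn_iff_continuous_restrict.1 hcont
    refine ⟨Function.extend (Subtype.val : S → ℝ × E) (S.restrict (V n)) (fun _ => 0),
      (MeasurableEmbedding.subtype_coe hS).stronglyMeasurable_extend hc'.stronglyMeasurable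
        stronglyMeasurable_const, fun p hp => ?_⟩
    have hpS : p ∈ S := mem_prod.2 ⟨hp, mem_univ _⟩
    rw [Function.extend_val_apply hpS]
    rfl
  choose G hGm hGval using hG
  refine ⟨fun t x => limUnder atTop (fun n => G n (t, x)), ?_, fun t ht => ?_⟩
  · exact StronglyMeasurable.limUnder (f := fun n p => G n p) hGm
  · have hloc : LocallyIntegrable (u t) volume :=
      (memLp_top_of_bound (hmeas t ht) M (Eventually.of_forall (hM t ht))).locallyIntegrable le_top
    -- the averages of the mollifications converge to the average
    have havg : Tendsto (fun n => ∫ y, g y • ((φ n).normed volume ⋆[lsmul ℝ ℝ, volume] (u t)) y) atTop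
        (𝓝 (∫ y, g y • u t y)) := by
      refine tendsto_integral_of_dominated_convergence (fun y => ‖g y‖ * M) (fun n => ?_) (hgi.norm.mul_const M)
        (fun n => Eventually.of_forall fun y => ?_) ?_
      · have hCc : Continuous ((φ n).normed volume ⋆[lsmul ℝ ℝ, volume] (u t)) :=
          (φ n).hasCompactSupport_normed.continuous_convolution_left (L := lsmul ℝ ℝ)
            (φ n).continuous_normed hloc
        exact hg.aestronglyMeasurable.smul hCc.aestronglyMeasurable
      · rw [norm_smul]
        exact mul_le_mul_of_nonneg_left (norm_convolution_normed_le (φ n) (hM t ht) y)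
          (norm_nonneg _)
      · filter_upwards [FunctionSpaces.ae_tendsto_normed_convolution hφ h'φ hloc] with y hy
        exact hy.const_smul (g y)
    filter_upwards [FunctionSpaces.ae_tendsto_normed_convolution hφ h'φ hloc] with x hx
    have hGx : (fun n => G n (t, x)) = fun n => V n (t, x) := funext fun n => hGval n (t, x) ht
    show limUnder atTop (fun n => G n (t, x)) = u t x - ∫ y, g y • u t y
    rw [hGx]
    exact (hx.sub havg).limUnder_eq

/-- **Bounded ancient mild solutions have bounded, jointly measurable modifications modulo their
averages.** For a bounded ancient mild solution `u` (`0 < ν`, duality form) with measurable slices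
and a continuous compactly supported weight `g` of unit mass there are a jointly strongly
measurable `w` and a bound `B` with `‖w‖ ≤ B` everywhere and `w(t) = u(t) − ∫ g u(t)` a.e. for
every `t < 0`: the pairings of `u` with differences of translates of test fields are continuous in
time (`continuousOn_integral_inner_sub_translate`, from the continuity of the solenoidal pairings,
`IsBoundedAncientMildSolution.continuousOn_integral_inner`), so
`exists_stronglyMeasurable_modification_sub_average` applies; the modification is then truncated
at the pointwise bound `M(1 + ∫|g|)` of `u(t) − ∫ g u(t)`. The subtracted `∫ g u(t)` is the
(possibly non-measurable in `t`) spatial constant `b(t)` of KNSS 2009, §1 p. 3.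
[cite: KochNadirashviliSereginSverak2009, §1 p. 3 (parasitic solutions u(x,t) = b(t))] -/
theorem IsBoundedAncientMildSolution.exists_modification_sub_average {ν : ℝ}
    (hu : IsBoundedAncientMildSolution ν u) (hν : 0 < ν)
    (hmeas : ∀ t < 0, AEStronglyMeasurable (u t) volume)
    {g : E → ℝ} (hg : Continuous g) (hgc : HasCompactSupport g) (hg1 : ∫ y, g y = 1) :
    ∃ w : ℝ → E → E, StronglyMeasurable (uncurry w) ∧ (∃ B : ℝ, ∀ t x, ‖w t x‖ ≤ B) ∧
      ∀ t < 0, w t =ᵐ[volume] fun x => u t x - ∫ y, g y • u t y := by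
  obtain ⟨M, hM'⟩ := hu.2
  have hM : ∀ t < 0, ∀ x, ‖u t x‖ ≤ M := fun t ht x => hM' t ht x
  have hM0 : 0 ≤ M := (norm_nonneg _).trans (hM (-1) (by norm_num) 0)
  have hsub : ∀ θ : E → E, FunctionSpaces.IsTestFunctionOn (⊤ : Opens E) θ → ∀ b : E,
      ContinuousOn (fun t => ∫ x, ⟪u t x, θ x - θ (x - b)⟫) (Iio 0) := fun θ hθ b =>
    continuousOn_integral_inner_sub_translate hM hmeas hu.1.1
      (fun φ hφ hdiv => hu.continuousOn_integral_inner hν hmeas hφ hdiv) hθ b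
  obtain ⟨w, hw, hwu⟩ := exists_stronglyMeasurable_modification_sub_average hM hmeas hsub hg hgc hg1
  have hgi : Integrable g := hg.integrable_of_hasCompactSupport hgc
  set B : ℝ := M + (∫ y, ‖g y‖) * M with hB
  -- the pointwise bound of `u t - ∫ g u t`
  have hbound : ∀ t < 0, ∀ x, ‖u t x - ∫ y, g y • u t y‖ ≤ B := by
    intro t ht x
    refine (norm_sub_le _ _).trans (add_le_add (hM t ht x) ?_)
    calc ‖∫ y, g y • u t y‖ ≤ ∫ y, ‖g y‖ * M :=
          norm_integral_le_of_norm_le (hgi.norm.mul_const M) (Eventually.of_forall fun y => by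
            rw [norm_smul]
            exact mul_le_mul_of_nonneg_left (hM t ht y) (norm_nonneg _))
      _ = (∫ y, ‖g y‖) * M := integral_mul_const _ _
  refine ⟨fun t x => if ‖w t x‖ ≤ B then w t x else 0, ?_, ⟨B, fun t x => ?_⟩, fun t ht => ?_⟩
  · exact StronglyMeasurable.ite (hw.norm.measurableSet_le stronglyMeasurable_const) hw
      stronglyMeasurable_const
  · by_cases h : ‖w t x‖ ≤ B
    · simp only [h, ↓reduceIte]
    · simp only [h, ↓reduceIte, norm_zero]
      exact hM0.trans ((le_add_iff_nonneg_right M).2 (by positivity))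
  · filter_upwards [hwu t ht] with x hx
    have h : ‖w t x‖ ≤ B := by rw [hx]; exact hbound t ht x
    rw [if_pos h, hx]

end Modification

/-! ### Measurability in time of the nonlinear integrands of a jointly measurable field -/

section Measurable

variable {F : Type*} [NormedAddCommGroup F] [NormedSpace ℝ F] [CompleteSpace F]

/-- **The caloric test field and its derivative are jointly continuous in the time parameter and
space**, in the form `(τ, x) ↦ D(e^{ν(q−τ)Δ}φ)(x)` for a test field `φ` (the derivative falls on
the data, `fderiv_heatFlow`, and `continuous_uncurry_heatTest_sub`). [folklore] -/
theorem continuous_fderiv_heatTest_sub {φ : E → F} (hφ : ContDiff ℝ 1 φ) (hc : HasCompactSupport φ)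
    (ν q : ℝ) : Continuous fun p : ℝ × E => fderiv ℝ (heatTest ν φ (q - p.1)) p.2 := by
  have hDc : Continuous (fderiv ℝ φ) := hφ.continuous_fderiv one_ne_zero
  obtain ⟨C, hC⟩ := hDc.bounded_above_of_compact_support (hc.fderiv ℝ)
  have h := continuous_uncurry_heatTest_sub hDc hC ν q
  refine h.congr fun p => ?_
  show heatFlow (fderiv ℝ φ) (ν * (q - p.1)) p.2 = fderiv ℝ (heatTest ν φ (q - p.1)) p.2
  rw [show heatTest ν φ (q - p.1) = heatFlow φ (ν * (q - p.1)) from rfl, fderiv_heatFlow hφ hc]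

variable {w : ℝ → E → E}

/-- **The nonlinear integrand of a jointly measurable field is measurable in time**:
`τ ↦ ∫⟪w τ, D(e^{ν(q−τ)Δ}φ)[w τ]⟫` is measurable for `w` jointly strongly measurable and a test
field `φ` (a parametric integral of a jointly strongly measurable integrand,
`StronglyMeasurable.integral_prod_right'`). [folklore] -/
theorem measurable_integral_inner_fderiv_heatTest_self (hw : StronglyMeasurable (uncurry w))
    {φ : E → E} (hφ : FunctionSpaces.IsTestFunctionOn (⊤ : Opens E) φ) (ν q : ℝ) :
    Measurable fun τ => ∫ x, ⟪w τ x, fderiv ℝ (heatTest ν φ (q - τ)) x (w τ x)⟫ := by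
  have hφ1 : ContDiff ℝ 1 φ := hφ.contDiff.of_le (by exact_mod_cast le_top)
  have hΦ := continuous_fderiv_heatTest_sub hφ1 hφ.hasCompactSupport ν q
  have hb : Continuous fun r : (E →L[ℝ] E) × E => ⟪r.2, r.1 r.2⟫ :=
    continuous_snd.inner isBoundedBilinearMap_apply.continuous
  have hF : StronglyMeasurable
      (uncurry fun τ x => ⟪w τ x, fderiv ℝ (heatTest ν φ (q - τ)) x (w τ x)⟫) :=
    hb.comp_stronglyMeasurable (hΦ.stronglyMeasurable.prodMk hw)
  exact hF.integral_prod_right.measurable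

/-- **The directional cross term is measurable in time**: `τ ↦ ∫⟪w τ, ∂ₑe^{ν(q−τ)Δ}φ⟫` is
measurable for `w` jointly strongly measurable, a test field `φ` and a vector `e`. [folklore] -/
theorem measurable_integral_inner_fderiv_heatTest_apply (hw : StronglyMeasurable (uncurry w))
    {φ : E → E} (hφ : FunctionSpaces.IsTestFunctionOn (⊤ : Opens E) φ) (ν q : ℝ) (e : E) :
    Measurable fun τ => ∫ x, ⟪w τ x, fderiv ℝ (heatTest ν φ (q - τ)) x e⟫ := by
  have hφ1 : ContDiff ℝ 1 φ := hφ.contDiff.of_le (by exact_mod_cast le_top)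
  have hΦ := continuous_fderiv_heatTest_sub hφ1 hφ.hasCompactSupport ν q
  have hb : Continuous fun r : (E →L[ℝ] E) × E => ⟪r.2, r.1 e⟫ :=
    continuous_snd.inner (continuous_fst.clm_apply continuous_const)
  have hF : StronglyMeasurable (uncurry fun τ x => ⟪w τ x, fderiv ℝ (heatTest ν φ (q - τ)) x e⟫) :=
    hb.comp_stronglyMeasurable (hΦ.stronglyMeasurable.prodMk hw)
  exact hF.integral_prod_right.measurable

end Measurable

/-! ### `ℝ³`: a radial weight, and the average of an axisymmetric field is axial -/

section Axial

omit [FiniteDimensional ℝ E] in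
/-- **A radial test weight of unit mass.** On a finite-dimensional inner product space there is a
smooth compactly supported `g ≥ 0` with `∫ g = 1` which is a function of the norm (hence invariant
under every map preserving the norm): a normalisation of `x ↦ smoothTransition (2 − ‖x‖²)`.
[folklore] -/
theorem exists_radial_test_weight [FiniteDimensional ℝ E] [Nontrivial E] :
    ∃ g : E → ℝ, FunctionSpaces.IsTestFunctionOn (⊤ : Opens E) g ∧ (∀ x, 0 ≤ g x) ∧ (∫ x, g x = 1) ∧
      ∀ x y : E, ‖x‖ = ‖y‖ → g x = g y := by
  set f : E → ℝ := fun x => Real.smoothTransition (2 - ‖x‖ ^ 2) with hf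
  have hfs : ContDiff ℝ ∞ f :=
    Real.smoothTransition.contDiff.comp (contDiff_const.sub (contDiff_norm_sq ℝ))
  have hsupp : support f ⊆ Metric.closedBall (0 : E) 2 := by
    intro x hx
    rw [mem_support] at hx
    rw [Metric.mem_closedBall, dist_zero_right]
    refine le_of_not_gt fun h => hx ?_
    have : 2 - ‖x‖ ^ 2 ≤ 0 := by nlinarith
    exact Real.smoothTransition.zero_of_nonpos this
  have hfc : HasCompactSupport f :=
    HasCompactSupport.of_support_subset_isCompact (isCompact_closedBall 0 2) hsupp
  have hf0 : ∀ x, 0 ≤ f x := fun x => Real.smoothTransition.nonneg _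
  have hfi : Integrable f := hfs.continuous.integrable_of_hasCompactSupport hfc
  -- `f = 1` on the unit ball, so `∫ f > 0`
  have hpos : 0 < ∫ x, f x := by
    have hone : ∀ x ∈ Metric.closedBall (0 : E) 1, f x = 1 := by
      intro x hx
      rw [Metric.mem_closedBall, dist_zero_right] at hx
      have : 1 ≤ 2 - ‖x‖ ^ 2 := by nlinarith [norm_nonneg x]
      exact Real.smoothTransition.one_of_one_le this
    have hle : (volume (Metric.closedBall (0 : E) 1)).toReal ≤ ∫ x, f x := by
      have h1 : ∫ x in Metric.closedBall (0 : E) 1, (1 : ℝ) ≤ ∫ x in Metric.closedBall (0 : E) 1, f x := by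
        refine setIntegral_mono_on (integrableOn_const (isCompact_closedBall _ _).measure_lt_top.ne)
          hfi.integrableOn Metric.isClosed_closedBall.measurableSet fun x hx => (hone x hx).symm.le
      have h2 : ∫ x in Metric.closedBall (0 : E) 1, f x ≤ ∫ x, f x :=
        setIntegral_le_integral hfi (Eventually.of_forall hf0)
      have h3 : ∫ x in Metric.closedBall (0 : E) 1, (1 : ℝ) = (volume (Metric.closedBall (0 : E) 1)).toReal := by
        simp [measureReal_def]
      linarith
    have hvol : 0 < (volume (Metric.closedBall (0 : E) 1)).toReal :=
      ENNReal.toReal_pos (Metric.measure_closedBall_pos volume _ one_pos).ne'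
        (isCompact_closedBall _ _).measure_lt_top.ne
    linarith
  refine ⟨fun x => f x / ∫ y, f y, ⟨hfs.div_const _, hfc.mono fun x hx => ?_, by simp⟩,
    fun x => div_nonneg (hf0 x) hpos.le, ?_, fun x y hxy => ?_⟩
  · rw [mem_support] at hx ⊢
    exact fun h0 => hx (by rw [h0, zero_div])
  · rw [integral_div, div_self hpos.ne']
  · show f x / _ = f y / _
    simp only [hf, hxy]

/-- **The average of an axisymmetric field against a radial weight is axial.** If `v : ℝ³ → ℝ³`
is pointwise axisymmetric (`v (R_θ x) = R_θ (v x)`), bounded and measurable, and the integrable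
weight `g` is invariant under the half-turn `R_π` about the axis, then
`∫ g v = (∫ g v₂) e_z`: the vector `c = ∫ g v` satisfies `R_π c = ∫ g(y) R_π v(y) dy =
∫ g(R_π y) v(R_π y) dy = c` (the rotation is linear and measure preserving), and a vector fixed by
the half-turn is axial (`eq_smul_eZ_of_rotZ_pi_eq`). [folklore] -/
theorem integral_smul_eq_smul_eZ_of_isAxisymmetric {g : EuclideanSpace ℝ (Fin 3) → ℝ} (hgi : Integrable g)
    (hgrot : ∀ y, g (rotZ Real.pi y) = g y) {v : EuclideanSpace ℝ (Fin 3) → EuclideanSpace ℝ (Fin 3)}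
    (hv : IsAxisymmetric v)
    (hvm : AEStronglyMeasurable v volume) {M : ℝ} (hM : ∀ x, ‖v x‖ ≤ M) :
    ∫ y, g y • v y = (∫ y, g y * v y 2) • eZ := by
  have hint : Integrable fun y => g y • v y :=
    Integrable.mono' (hgi.norm.mul_const M) (hgi.aestronglyMeasurable.smul hvm)
      (Eventually.of_forall fun y => by
        rw [norm_smul]
        exact mul_le_mul_of_nonneg_left (hM y) (norm_nonneg _))
  set c : EuclideanSpace ℝ (Fin 3) := ∫ y, g y • v y with hc_def
  -- `R_π c = c`
  have h1 : rotZ Real.pi c = c := by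
    have hL : rotZ Real.pi c = ∫ y, rotZ Real.pi (g y • v y) := by
      show rotZL Real.pi c = ∫ y, rotZL Real.pi (g y • v y)
      exact ((rotZL Real.pi).integral_comp_comm hint).symm
    have h2 : ∀ y, rotZ Real.pi (g y • v y) = g (rotZ Real.pi y) • v (rotZ Real.pi y) := fun y => by
      rw [hv Real.pi y, hgrot y]
      show rotZL Real.pi (g y • v y) = g y • rotZL Real.pi (v y)
      exact map_smul _ _ _
    rw [hL]
    simp_rw [h2]
    exact (measurePreserving_rotZ Real.pi).integral_comp (rotZLIE Real.pi).toHomeomorph.measurableEmbedding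
      (fun y => g y • v y)
  have hc : c = c 2 • eZ := eq_smul_eZ_of_rotZ_pi_eq h1
  have hc2 : c 2 = ∫ y, g y * v y 2 := by
    rw [hc_def, show (∫ y, g y • v y) 2 = EuclideanSpace.proj (𝕜 := ℝ) (2 : Fin 3) (∫ y, g y • v y) from rfl,
      ← (EuclideanSpace.proj (𝕜 := ℝ) (2 : Fin 3)).integral_comp_comm hint]
    exact integral_congr_ae (Eventually.of_forall fun y => by simp [smul_eq_mul])
  rw [← hc2]
  exact hc

/-- **Invariance of axisymmetry and of the swirl under axial shifts**: adding a constant multiple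
of `e_z` to a field preserves pointwise axisymmetry and the swirl (the rotations fix `e_z`, and
`e_z` has no horizontal components). [folklore] -/
theorem isAxisymmetric_add_smul_eZ {v : EuclideanSpace ℝ (Fin 3) → EuclideanSpace ℝ (Fin 3)}
    (hv : IsAxisymmetric v) (a : ℝ) :
    IsAxisymmetric fun x => v x + a • eZ := by
  intro θ x
  show v (rotZ θ x) + a • eZ = rotZ θ (v x + a • eZ)
  rw [hv θ x, show rotZ θ (v x + a • eZ) = rotZL θ (v x + a • eZ) from rfl, map_add, map_smul,
    rotZL_apply, rotZL_apply]
  congr 2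
  ext i
  fin_cases i <;> simp [eZ]

/-- The swirl does not see an axial shift: `Γ(v + a e_z) = Γ(v)`. [folklore] -/
theorem swirl_add_smul_eZ (v : EuclideanSpace ℝ (Fin 3) → EuclideanSpace ℝ (Fin 3)) (a : ℝ)
    (x : EuclideanSpace ℝ (Fin 3)) :
    swirl (fun y => v y + a • eZ) x = swirl v x := by
  simp [swirl, eZ]

/-- No swirl is preserved by axial shifts. [folklore] -/
theorem hasNoSwirl_add_smul_eZ {v : EuclideanSpace ℝ (Fin 3) → EuclideanSpace ℝ (Fin 3)}
    (hv : HasNoSwirl v) (a : ℝ) :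
    HasNoSwirl fun x => v x + a • eZ := fun x => by
  rw [swirl_add_smul_eZ]
  exact hv x

end Axial

end Literature.Analysis.FluidPDE
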